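import Summits.BirchSwinnertonDyer.BirchSwinnertonDyer.Theorems.GenusKolyvaginAtTwoGenusPrimitiveSupplyAtTwoArchimedeanLevelLaw
import Summits.BirchSwinnertonDyer.BirchSwinnertonDyer.Theorems.GenusKolyvaginAtTwoGenusPrimitiveSupplyAtTwoPrimeHeegnerTwinSilentPrimes
import HarnessLib

/-!
# Route `GenusKolyvaginAtTwo`, crux #2 `GenusPrimitiveSupplyAtTwo` (stmt-BirchSwinnertonDyer-22136):
# the descent sign `ε(W)` IS the strictness of `Sel₂(W)` at `∞` (habitat, modulo {PT, Tate χ, Kramer parity})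

Width seat `bsd-line-gk2-p5` g9 (cell `bsd-f1-sign2`, SUPPLY lineage, «UP general-K lane»), file 29 of the series (sequel of
`…ArchimedeanLevelLaw.lean` p639555). THEOREMS ONLY (no definition, no named fact, no `sorry`, no local instance); helper
`--supports stmt-BirchSwinnertonDyer-22136`; no item is closed; BSD is not proved by any of this.

WHAT. The cell's descent sign `F1Sign2.DescentSignNeg W` («some descent-admissible twist DOUBLES `#Sel₂`») was an external datum of the
Δ > 0 supply rows. By the level law (file 27) it is an INTRINSIC property of `W`: on the habitat (`ρ̄_{W,2}` onto, `Δ_W > 0`, `W` globally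
minimal, `#Sel₂(W) ≠ 0`),

* §72 `descentSignNeg_iff_strict_habitat_of_parity` — `DescentSignNeg W ↔` every class of `Sel₂(W)` localises to `0` in `H¹(ℝ, W[2])`
  (`Sel₂(W)` is STRICT at `∞`; equivalently no Selmer class «meets the egg»); `not_descentSignNeg_iff_exists_habitat_of_parity` — the
  negation: some Selmer class is non-trivial at `∞`. (A descent-admissible `d` exists: the silent primes of g7's `exists_silent_prime_gt`.)

References: [MazurRubin2010] Thm. 2.7, Lemma 2.9, Cor. 3.4 (i); [Kramer1981] §2 Prop. 6, Thm. 1.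
-/

set_option linter.dupNamespace false -- tree convention: `Summit.BirchSwinnertonDyer.BirchSwinnertonDyer.Theorems` (summit = sub-problem)
set_option autoImplicit false

noncomputable section

open scoped Classical ContRepresentation

namespace Summit.BirchSwinnertonDyer.BirchSwinnertonDyer.Theorems.GenusKolyArch

open WeierstrassCurve Field NumberField IsDedekindDomain Function
open Literature.NumberTheory.EllipticCurves Literature.NumberTheory.GaloisRepresentations
open Literature.NumberTheory.GaloisCohomology
open Summit.BirchSwinnertonDyer.Rank1Residual.F1Sign2
open Summit.BirchSwinnertonDyer.BirchSwinnertonDyer.Theorems.GenusKolyTwin (exists_silent_prime_gt descAdmissible_neg_prime_of_silent)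

variable (W : WeierstrassCurve ℚ) [W.IsElliptic] [W.IsGloballyMinimal]

/-! ## §72 `ε(W) = −1` iff `Sel₂(W)` is strict at `∞` -/

/-- **The descent sign is the strictness of `Sel₂(W)` at the real place** (habitat, modulo {PT, Tate χ, Kramer parity}): for `W/ℚ` globally
minimal with `ρ̄_{W,2}` onto, `Δ_W > 0` and `#Sel₂(W) ≠ 0`, `F1Sign2.DescentSignNeg W` (some descent-admissible twist doubles `#Sel₂`) holds
iff every class of `Sel₂(W)` localises to `0` at `∞`. (⇐: the level law, UP for every admissible `d`, and a silent admissible prime exists;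
⇒: otherwise DOWN `2·#Sel₂(W^{(d)}) = #Sel₂(W)` contradicts the doubling.) [cite: MazurRubin2010, Thm. 2.7, Cor. 3.4 (i)] [cite: Kramer1981, §2 Prop. 6] -/
theorem descentSignNeg_iff_strict_habitat_of_parity
    (hPT : poitouTate_selmerStructure_duality_real ℚ)
    (hEP : ∀ v : HeightOneSpectrum (𝓞 ℚ), localEulerPoincareCharacteristic (v.adicCompletion ℚ))
    (hKP : MazurRubin2010.kramerParity ℚ) (hsurj : W.HasSurjectiveModNGaloisRep 2) (hΔ : 0 < W.Δ)
    (h0 : selmerTwoCard W ≠ 0) :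
    DescentSignNeg W ↔
      ∀ c ∈ (W.kummerSelmerStructure ((2 : ℕ) : ℤ)).selmerGroup,
        galoisCohomology.localization (W.torsionGaloisModule ((2 : ℕ) : ℤ)) (Sum.inl Rat.infinitePlace) 1 c = 0 := by
  constructor
  · rintro ⟨d, hd, h2⟩
    by_contra hns
    push Not at hns
    obtain ⟨c, hc, hne⟩ := hns
    have h := two_mul_twistSelmerTwoCard_eq_of_exists W hPT hEP hΔ ⟨c, hc, hne⟩ hd
    omega
  · intro hstrict
    obtain ⟨ℓ, -, hℓ, hℓ8, hℓN, hsil⟩ := exists_silent_prime_gt W hΔ hsurj 0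
    exact ⟨-(ℓ : ℤ), descAdmissible_neg_prime_of_silent W hℓ hℓ8 hℓN hsil,
      twistSelmerTwoCard_eq_two_mul_of_strict W hPT hEP hKP hsurj hΔ hstrict
        (descAdmissible_neg_prime_of_silent W hℓ hℓ8 hℓN hsil)⟩

/-- **`ε(W) = +1` iff some class of `Sel₂(W)` is non-trivial at `∞`** (habitat, modulo {PT, Tate χ, Kramer parity}).
[cite: MazurRubin2010, Thm. 2.7, Cor. 3.4 (i)] [cite: Kramer1981, §2 Prop. 6] -/
theorem not_descentSignNeg_iff_exists_habitat_of_parity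
    (hPT : poitouTate_selmerStructure_duality_real ℚ)
    (hEP : ∀ v : HeightOneSpectrum (𝓞 ℚ), localEulerPoincareCharacteristic (v.adicCompletion ℚ))
    (hKP : MazurRubin2010.kramerParity ℚ) (hsurj : W.HasSurjectiveModNGaloisRep 2) (hΔ : 0 < W.Δ)
    (h0 : selmerTwoCard W ≠ 0) :
    ¬ DescentSignNeg W ↔
      ∃ c ∈ (W.kummerSelmerStructure ((2 : ℕ) : ℤ)).selmerGroup,
        galoisCohomology.localization (W.torsionGaloisModule ((2 : ℕ) : ℤ)) (Sum.inl Rat.infinitePlace) 1 c ≠ 0 := by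
  rw [descentSignNeg_iff_strict_habitat_of_parity W hPT hEP hKP hsurj hΔ h0]
  push Not
  rfl

end Summit.BirchSwinnertonDyer.BirchSwinnertonDyer.Theorems.GenusKolyArch

end
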